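import Literature.Barriers.CriticalPhenomena.LongRangeTrivialityOnZ3Field
import Literature.Probability.LatticeModels.IsingPeierls
import Literature.Barriers.HubbardSuperconductivity.WeakCouplingCeiling

/-!
# Fisher's high-temperature bound for ferromagnetic pair interactions: `m*(β) = 0` for `β|J| < 1`,
# i.e. `β_c ≥ |J|⁻¹`

Sibling of `Literature/Barriers/CriticalPhenomena/LongRangeTrivialityOnZ3.lean` (barrier catalogue
D-0021, sub-problem `Ising3DConformalLimit`); second file serving the discharge of
`Literature.Barriers.CriticalPhenomena.panis_criticalBeta_pos` (Panis 2023, §1.2.1: "The above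
assumptions guarantee [Fisher 1967] that `β_c > 0` (in fact `β_c ≥ |J|⁻¹`)", where
`|J| := sup_x ∑_y J_{x,y}` is assumption (A2), p. 5 of arXiv:2309.05797). The source cites
M. E. Fisher, Phys. Rev. 162 (1967) 480, and prints no proof; the proof below is the elementary
"mean-field" one through Griffiths' inequalities, valid for every ferromagnetic symmetric pair
interaction `J ≥ 0` in a field `h ≥ 0` at `β ≥ 0`, in the parametrisation of the barrier file
(`⟨·⟩_{Λ,J,h,β} ∝ exp[(β/2)∑_{x,y∈Λ}J_{x,y}σ_xσ_y + βh∑σ_x]`, `LongRangeIsing.expectIn`):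

1. **Switching on one interaction term** (`gksExpect_le_off_add`): for a spin system `ν_{Λ;K}` of
   Friedli–Velenik §3.8.1 with `K ≥ 0` and a term `i` with support `Cᵢ`, since
   `e^{Kᵢω_{Cᵢ}} = cosh Kᵢ + ω_{Cᵢ} sinh Kᵢ`,
   `⟨σ_A⟩_K = (⟨σ_A⟩' cosh Kᵢ + ⟨σ_{A∆Cᵢ}⟩' sinh Kᵢ)/(cosh Kᵢ + ⟨σ_{Cᵢ}⟩' sinh Kᵢ) ≤ ⟨σ_A⟩' + tanh Kᵢ ⟨σ_{A∆Cᵢ}⟩'`,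
   `⟨·⟩'` the system with `Kᵢ` switched off (GKS I makes all three primed correlations `≥ 0`);
   iterating over a set `T` of terms and using Griffiths' comparison `⟨σ_B⟩_{K off T} ≤ ⟨σ_B⟩_K`
   (`gksExpect_le_off_add_sum`): `⟨σ_A⟩_K ≤ ⟨σ_A⟩_{K off T} + ∑_{i∈T} tanh Kᵢ ⟨σ_{A∆Cᵢ}⟩_K`.
2. **The one-site bound** (`expectIn_spinAt_le`): with `A = {x}` and `T` the terms through `x`, the
   switched-off system does not see `σ_x` (`gksSum_spinAt_eq_zero_of_decoupled`, the spin flip `flipOn {x}` at `x`), and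
   the sum is `tanh(βh) + ∑_{y≠x}2tanh(βJ_{x,y}/2)⟨σ_y⟩ ≤ βh + β∑_y J_{x,y}⟨σ_y⟩_{Λ,J,h,β}` — the
   finite-volume mean-field inequality `⟨σ_x⟩ ≤ βh + β∑_y J_{x,y}⟨σ_y⟩` (cf. Duminil-Copin–Tassion
   2016, `φ_β({0}) = ∑_y tanh(βJ_{0,y})`).
3. **Fisher's bound** (`expectIn_spinAt_le_of_sum_le`, `state_spinAt_le_of_sum_le`,
   `magnetization_nonpos_of_mul_lt_one`, `one_le_mul_of_magnetization_pos`): if `∑_{y∈Λ}J_{x,y} ≤ S`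
   for all `x` then the maximum `M_Λ` of the one-point functions over `Λ` obeys
   `M_Λ ≤ βh + βS M_Λ`, so for `βS < 1`, `⟨σ_x⟩_{Λ,J,h,β} ≤ βh/(1-βS)` uniformly in `Λ`; letting
   `Λ ↑ ℤ^d` and `h → 0⁺` (`LongRangeTrivialityOnZ3Field`), `m*(β) ≤ 0`: a `β > 0` with `m*(β) > 0`
   has `βS ≥ 1`, which is `β_c ≥ |J|⁻¹` once `S = |J|`.

The specialisation `S = |J| = ∑_y C₀|y|₁^{-d-α} < ∞` for the algebraically decaying couplings and the
assembly of `0 < β_c` are in `LongRangeTrivialityOnZ3CriticalBeta.lean`.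

## References

* R. Panis, arXiv:2309.05797 (2023) = Ann. Probab. 54 (2026), §1.2.1, (A2) and the sentence on
  `β_c ≥ |J|⁻¹` [Panis2023Triviality] (held; read pp. 5–6).
* M. E. Fisher, *Critical temperatures of anisotropic Ising lattices. II. General upper bounds*,
  Phys. Rev. 162 (1967) 480–485 (as cited there; not consulted).
* S. Friedli, Y. Velenik, *Statistical Mechanics of Lattice Systems*, CUP (2017), §3.8.1 Thm. 3.49,
  eq. (3.44), Exercise 3.31 [FriedliVelenik2017].
* H. Duminil-Copin, V. Tassion, Comm. Math. Phys. 343 (2016) 725–745, §2 (`φ_β(S)`)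
  [DuminilCopinTassionCMP2016].
-/

noncomputable section

namespace Literature.Barriers.CriticalPhenomena

open Literature.Probability.LatticeModels Literature.Probability.Percolation Filter Topology Finset
open scoped symmDiff

namespace LongRangeIsing

/-! ### Switching on one interaction term of `ν_{Λ;K}` -/

section Switching

variable {Λ : Type*} [Fintype Λ] [DecidableEq Λ] {ι : Type*} [DecidableEq ι]
variable (s : Finset ι) (K : ι → ℝ) (C : ι → Finset Λ)

/-- `cplOff K T ≥ 0` on `s` when `K ≥ 0` on `s`. [folklore] -/
theorem cplOff_nonneg' (hK : ∀ i ∈ s, 0 ≤ K i) (T : Finset ι) : ∀ i ∈ s, 0 ≤ cplOff K T i := by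
  intro i hi
  unfold cplOff
  split_ifs
  exacts [le_rfl, hK i hi]

/-- `|cplOff K T i| ≤ Kᵢ` on `s` when `K ≥ 0` on `s`. [folklore] -/
theorem abs_cplOff_le (hK : ∀ i ∈ s, 0 ≤ K i) (T : Finset ι) : ∀ i ∈ s, |cplOff K T i| ≤ K i := by
  intro i hi
  unfold cplOff
  split_ifs
  · rw [abs_zero]; exact hK i hi
  · rw [abs_of_nonneg (hK i hi)]

/-- Switching off `{j}` after `T` is switching off `insert j T`. [folklore] -/
theorem cplOff_cplOff_singleton (T : Finset ι) (j : ι) :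
    cplOff (cplOff K T) {j} = cplOff K (insert j T) := by
  funext i
  unfold cplOff
  by_cases hij : i = j
  · subst hij; simp
  · simp [hij]

/-- Switching off nothing changes nothing. [folklore] -/
theorem cplOff_empty : cplOff K (∅ : Finset ι) = K := by
  funext i
  simp [cplOff]

/-- **The switching identity** `Z_K⟨f⟩_K = cosh Kᵢ · Z'⟨f⟩' + sinh Kᵢ · Z'⟨f ω_{Cᵢ}⟩'` (`i ∈ s`,
primes = term `i` switched off), from `e^{Kᵢω_{Cᵢ}} = cosh Kᵢ + ω_{Cᵢ} sinh Kᵢ`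
(Friedli–Velenik 2017, eq. (3.44)). [cite: FriedliVelenik2017, eq. (3.44), p. 124] -/
theorem gksSum_eq_cosh_mul_add_sinh_mul {i : ι} (hi : i ∈ s) (f : SpinConfig Λ → ℝ) :
    gksSum s K C f = Real.cosh (K i) * gksSum s (cplOff K {i}) C f +
      Real.sinh (K i) * gksSum s (cplOff K {i}) C (fun ω => f ω * spinProduct (C i) ω) := by
  simp only [gksSum, Finset.mul_sum, ← Finset.sum_add_distrib]
  refine Finset.sum_congr rfl fun ω _ => ?_
  rw [gksWeight_eq_off_mul_exp s K C {i} (Finset.singleton_subset_iff.2 hi) ω, Finset.sum_singleton,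
    exp_mul_eq_cosh_add_mul_sinh (K i) (spinProduct_eq_one_or (C i) ω)]
  ring

/-- **Switching on one ferromagnetic term costs at most `tanh Kᵢ ⟨σ_{A∆Cᵢ}⟩'`**: for `K ≥ 0` and
`i ∈ s`, `⟨σ_A⟩_K ≤ ⟨σ_A⟩_{K off i} + tanh Kᵢ ⟨σ_{A∆Cᵢ}⟩_{K off i}` (the switching identity in
numerator and denominator, `Z_K ≥ cosh Kᵢ Z'` and GKS I). [cite: FriedliVelenik2017, Thm. 3.49, eq. (3.54), p. 141] -/
theorem gksExpect_le_off_add (hK : ∀ j ∈ s, 0 ≤ K j) {i : ι} (hi : i ∈ s) (A : Finset Λ) :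
    gksExpect s K C (spinProduct A) ≤ gksExpect s (cplOff K {i}) C (spinProduct A) +
      Real.tanh (K i) * gksExpect s (cplOff K {i}) C (spinProduct (A ∆ C i)) := by
  set K' := cplOff K {i} with hK'
  have hK'0 : ∀ j ∈ s, 0 ≤ K' j := cplOff_nonneg' s K hK {i}
  set c := Real.cosh (K i) with hc
  set t := Real.sinh (K i) with ht
  have hcpos : 0 < c := Real.cosh_pos _
  have htnn : 0 ≤ t := Real.sinh_nonneg_iff.2 (hK i hi)
  set a := gksSum s K' C (spinProduct A) with ha
  set b := gksSum s K' C (spinProduct (A ∆ C i)) with hb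
  set Z' := gksSum s K' C (fun _ => 1) with hZ'
  set m := gksSum s K' C (spinProduct (C i)) with hm
  have ha0 : 0 ≤ a := gksSum_spinProduct_nonneg s K' C hK'0 A
  have hb0 : 0 ≤ b := gksSum_spinProduct_nonneg s K' C hK'0 _
  have hm0 : 0 ≤ m := gksSum_spinProduct_nonneg s K' C hK'0 _
  have hZ'pos : 0 < Z' := gksSum_one_pos s K' C
  have hN : gksSum s K C (spinProduct A) = c * a + t * b := by
    rw [gksSum_eq_cosh_mul_add_sinh_mul s K C hi]
    simp_rw [spinProduct_mul_eq_spinProduct_symmDiff]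
    rfl
  have hZ : gksSum s K C (fun _ => 1) = c * Z' + t * m := by
    rw [gksSum_eq_cosh_mul_add_sinh_mul s K C hi]
    simp_rw [one_mul]
    rfl
  have hexp : gksExpect s K C (spinProduct A) = (c * a + t * b) / (c * Z' + t * m) := by
    rw [gksExpect, hN, hZ]
  have h1 : (c * a + t * b) / (c * Z' + t * m) ≤ (c * a + t * b) / (c * Z') :=
    div_le_div_of_nonneg_left (by positivity) (by positivity) (by nlinarith)
  have h2 : (c * a + t * b) / (c * Z') = a / Z' + t / c * (b / Z') := by
    field_simp
  rw [hexp, gksExpect, gksExpect, Real.tanh_eq_sinh_div_cosh, ← hc, ← ht]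
  linarith [h1, h2.le]

/-- **Iterated switching**: for `K ≥ 0` and `T ⊆ s`,
`⟨σ_A⟩_K ≤ ⟨σ_A⟩_{K off T} + ∑_{i∈T} tanh Kᵢ ⟨σ_{A∆Cᵢ}⟩_K` (switch the terms of `T` on one at a
time and bound the intermediate correlations by Griffiths' comparison `gksExpect_mono_of_abs_le`).
[cite: FriedliVelenik2017, Exercise 3.31, p. 142] -/
theorem gksExpect_le_off_add_sum (hK : ∀ j ∈ s, 0 ≤ K j) {T : Finset ι} (hT : T ⊆ s) (A : Finset Λ) :
    gksExpect s K C (spinProduct A) ≤ gksExpect s (cplOff K T) C (spinProduct A) +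
      ∑ i ∈ T, Real.tanh (K i) * gksExpect s K C (spinProduct (A ∆ C i)) := by
  induction T using Finset.induction_on with
  | empty => simp [cplOff_empty]
  | insert j T hj ih =>
    have hjs : j ∈ s := hT (Finset.mem_insert_self j T)
    have hTs : T ⊆ s := (Finset.subset_insert j T).trans hT
    have hKT : ∀ i ∈ s, 0 ≤ cplOff K T i := cplOff_nonneg' s K hK T
    have hstep := gksExpect_le_off_add s (cplOff K T) C hKT hjs A
    rw [cplOff_cplOff_singleton] at hstep
    have hKj : cplOff K T j = K j := by simp [cplOff, hj]
    rw [hKj] at hstep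
    have hmono : gksExpect s (cplOff K (insert j T)) C (spinProduct (A ∆ C j)) ≤
        gksExpect s K C (spinProduct (A ∆ C j)) :=
      gksExpect_mono_of_abs_le s C (abs_cplOff_le s K hK (insert j T)) _
    have htanh : 0 ≤ Real.tanh (K j) := by
      rw [Real.tanh_eq_sinh_div_cosh]
      exact div_nonneg (Real.sinh_nonneg_iff.2 (hK j hjs)) (Real.cosh_pos _).le
    rw [Finset.sum_insert hj]
    nlinarith [ih hTs, hstep, mul_le_mul_of_nonneg_left hmono htanh]

omit [Fintype Λ] in
/-- Spin products avoiding `x` are unchanged by the spin flip at `x` (the tree's `flipOn {x}` of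
`MessagerMiracleSole`). [folklore] -/
theorem spinProduct_flipOn_singleton_of_not_mem {x : Λ} {B : Finset Λ} (h : x ∉ B) (ω : SpinConfig Λ) :
    spinProduct B (flipOn {x} ω) = spinProduct B ω :=
  Finset.prod_congr rfl fun y hy => by
    rw [spinAt_flipOn, if_neg]
    rw [Finset.mem_singleton]
    rintro rfl
    exact h hy

omit [DecidableEq ι] in
/-- **A decoupled site has zero magnetisation**: if every term through `x` has coupling `0`, then
`Z⟨σ_x⟩ = 0` (the weight is invariant under the spin flip at `x`, which reverses `σ_x`). [folklore] -/
theorem gksSum_spinAt_eq_zero_of_decoupled {x : Λ} (hx : ∀ i ∈ s, x ∈ C i → K i = 0) :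
    gksSum s K C (spinProduct {x}) = 0 := by
  have hw : ∀ ω, gksWeight s K C (flipOn {x} ω) = gksWeight s K C ω := by
    intro ω
    rw [gksWeight, gksWeight, gksHamiltonian, gksHamiltonian]
    congr 1
    refine Finset.sum_congr rfl fun i hi => ?_
    by_cases hxi : x ∈ C i
    · rw [hx i hi hxi, zero_mul, zero_mul]
    · rw [spinProduct_flipOn_singleton_of_not_mem hxi]
  have hinv : Function.Involutive (flipOn {x} : SpinConfig Λ → SpinConfig Λ) := flipOn_involutive {x}
  have hsum : gksSum s K C (spinProduct {x}) = -gksSum s K C (spinProduct {x}) := by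
    rw [gksSum]
    conv_lhs => rw [← Equiv.sum_comp hinv.toPerm]
    rw [← Finset.sum_neg_distrib]
    refine Finset.sum_congr rfl fun ω _ => ?_
    rw [Function.Involutive.coe_toPerm, hw, spinProduct, spinProduct, Finset.prod_singleton,
      Finset.prod_singleton, spinAt_flipOn, if_pos (Finset.mem_singleton_self x)]
    ring
  linarith

end Switching

/-! ### The one-site mean-field bound `⟨σ_x⟩ ≤ βh + β∑_y J_{x,y}⟨σ_y⟩` in finite volume -/

section OneSite

variable {d : ℕ} (J : Site d → Site d → ℝ) (Λ : Finset (Site d)) (β h : ℝ)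

/-- The trace of `{y}` on `Λ ∋ y` is `{y}`. [folklore] -/
theorem inVol_singleton_coe (y : ↥Λ) : inVol Λ ({(y : Site d)} : Finset (Site d)) = {y} := by
  ext z
  rw [mem_inVol, Finset.mem_singleton, Finset.mem_singleton]
  exact Subtype.ext_iff.symm

/-- `⟨σ_y⟩_{Λ,J,h,β}` for `y ∈ Λ` in the spin-system form. [folklore] -/
theorem expectIn_spinAt_eq_gksExpect (y : ↥Λ) :
    expectIn J Λ β h (spinAt (y : Site d)) =
      gksExpect (univ : Finset ((↥Λ × ↥Λ) ⊕ ↥Λ)) (Sum.elim (fun p : ↥Λ × ↥Λ => β / 2 * J p.1 p.2) fun _ => β * h) (Sum.elim (fun p : ↥Λ × ↥Λ => {p.1} ∆ {p.2}) fun z => {z})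
        (spinProduct {y}) := by
  rw [← spinProduct_singleton_eq_spinAt, expectIn_spinProduct_eq_gksExpect_field, inVol_singleton_coe]

/-- **The finite-volume mean-field inequality**: for a symmetric ferromagnetic pair interaction
`J ≥ 0`, `β, h ≥ 0` and `x ∈ Λ`,
`⟨σ_x⟩_{Λ,J,h,β} ≤ βh + β ∑_{y∈Λ} J_{x,y} ⟨σ_y⟩_{Λ,J,h,β}`
(switch off the field at `x` and the pairs through `x`; the decoupled `σ_x` has mean zero; each
switched term costs `tanh Kᵢ ≤ Kᵢ` — `tanh_le_self` of `WeakCouplingCeiling` — times a one-point function). [cite: FriedliVelenik2017, Thm. 3.49 and eq. (3.44)] -/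
theorem expectIn_spinAt_le (hβ : 0 ≤ β) (hh : 0 ≤ h) (hJ : ∀ x y, 0 ≤ J x y)
    (hJs : ∀ x y, J x y = J y x) {x : Site d} (hx : x ∈ Λ) :
    expectIn J Λ β h (spinAt x) ≤ β * h + β * ∑ y ∈ Λ, J x y * expectIn J Λ β h (spinAt y) := by
  classical
  set x' : ↥Λ := ⟨x, hx⟩ with hx'
  set s : Finset ((↥Λ × ↥Λ) ⊕ ↥Λ) := univ with hs
  set K : (↥Λ × ↥Λ) ⊕ ↥Λ → ℝ := (Sum.elim (fun p : ↥Λ × ↥Λ => β / 2 * J p.1 p.2) fun _ => β * h) with hKdef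
  set C : (↥Λ × ↥Λ) ⊕ ↥Λ → Finset ↥Λ := (Sum.elim (fun p : ↥Λ × ↥Λ => {p.1} ∆ {p.2}) fun z => {z}) with hCdef
  have hK : ∀ i ∈ s, 0 ≤ K i := fun i _ => pairFieldCoupling_nonneg J Λ β h hβ hh hJ i
  -- the one-point functions in spin-system form
  set E : Finset ↥Λ → ℝ := fun B => gksExpect s K C (spinProduct B) with hE
  have hE0 : ∀ B, 0 ≤ E B := fun B => gksExpect_spinProduct_nonneg s K C hK B
  have hEy : ∀ y : ↥Λ, expectIn J Λ β h (spinAt (y : Site d)) = E {y} := fun y =>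
    expectIn_spinAt_eq_gksExpect J Λ β h y
  have hEempty : E ∅ = 1 := by
    have h1 : (spinProduct (∅ : Finset ↥Λ) : SpinConfig ↥Λ → ℝ) = fun _ => 1 :=
      funext fun ω => spinProduct_empty ω
    simp only [hE]
    rw [h1, gksExpect, div_self (gksSum_one_pos s K C).ne']
  -- the terms through `x`
  set T : Finset ((↥Λ × ↥Λ) ⊕ ↥Λ) := univ.filter fun i => x' ∈ C i with hT
  have hTs : T ⊆ s := Finset.filter_subset _ _
  have hoff : gksExpect s (cplOff K T) C (spinProduct {x'}) = 0 := by
    rw [gksExpect, gksSum_spinAt_eq_zero_of_decoupled s (cplOff K T) C (x := x') ?_, zero_div]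
    intro i _ hxi
    have hiT : i ∈ T := Finset.mem_filter.2 ⟨Finset.mem_univ _, hxi⟩
    simp [cplOff, hiT]
  have hmain := gksExpect_le_off_add_sum s K C hK hTs {x'}
  rw [hoff, zero_add] at hmain
  -- bound the switched terms by `F i = 1{x ∈ Cᵢ} Kᵢ E({x} ∆ Cᵢ)` summed over all terms
  set F : (↥Λ × ↥Λ) ⊕ ↥Λ → ℝ := fun i => if x' ∈ C i then K i * E ({x'} ∆ C i) else 0 with hF
  have hF0 : ∀ i, 0 ≤ F i := fun i => by
    simp only [hF]
    split_ifs
    · exact mul_nonneg (hK i (Finset.mem_univ _)) (hE0 _)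
    · exact le_rfl
  have hsumT : ∑ i ∈ T, Real.tanh (K i) * E ({x'} ∆ C i) ≤ ∑ i, F i := by
    calc ∑ i ∈ T, Real.tanh (K i) * E ({x'} ∆ C i) ≤ ∑ i ∈ T, F i := by
          refine Finset.sum_le_sum fun i hi => ?_
          have hxi : x' ∈ C i := (Finset.mem_filter.1 hi).2
          simp only [hF, if_pos hxi]
          exact mul_le_mul_of_nonneg_right
            (Literature.Barriers.HubbardSuperconductivity.tanh_le_self (hK i (Finset.mem_univ _))) (hE0 _)
      _ ≤ ∑ i, F i := Finset.sum_le_sum_of_subset_of_nonneg (Finset.subset_univ T) fun i _ _ => hF0 i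
  -- the field term
  have hFinr : ∑ z : ↥Λ, F (Sum.inr z) = β * h := by
    have h1 : ∀ z : ↥Λ, F (Sum.inr z) = if z = x' then β * h else 0 := by
      intro z
      simp only [hF, hCdef, Sum.elim_inr, Finset.mem_singleton, hKdef]
      by_cases hz : z = x'
      · subst hz
        simp [hEempty]
      · rw [if_neg (Ne.symm hz), if_neg hz]
    simp_rw [h1]
    rw [Finset.sum_ite_eq' univ x', if_pos (Finset.mem_univ _)]
  -- the pair terms
  set G : ↥Λ × ↥Λ → ℝ := fun p =>
    (if p.1 = x' then β / 2 * J x p.2 * E {p.2} else 0) + (if p.2 = x' then β / 2 * J p.1 x * E {p.1} else 0)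
    with hG
  have hFG : ∀ p : ↥Λ × ↥Λ, F (Sum.inl p) ≤ G p := by
    rintro ⟨z, w⟩
    simp only [hF, hG, hCdef, Sum.elim_inl, hKdef, Finset.mem_symmDiff, Finset.mem_singleton]
    by_cases hz : z = x' <;> by_cases hw : w = x'
    · subst hz; subst hw
      simp only [not_true_eq_false, and_false, or_self, if_false, if_true]
      exact add_nonneg (mul_nonneg (mul_nonneg (by positivity) (hJ _ _)) (hE0 _))
        (mul_nonneg (mul_nonneg (by positivity) (hJ _ _)) (hE0 _))
    · subst hz
      have hxw : x' ≠ w := Ne.symm hw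
      have hset : ({x'} : Finset ↥Λ) ∆ ({x'} ∆ {w}) = {w} := symmDiff_symmDiff_cancel_left _ _
      simp only [hxw, not_false_eq_true, and_self, not_true_eq_false, or_false, if_true,
        hw, if_false, add_zero, hset]
      exact le_rfl
    · subst hw
      have hxz : x' ≠ z := Ne.symm hz
      have hset : ({x'} : Finset ↥Λ) ∆ ({z} ∆ {x'}) = {z} := by
        rw [symmDiff_comm ({z} : Finset ↥Λ) {x'}]
        exact symmDiff_symmDiff_cancel_left _ _
      simp only [hxz, not_false_eq_true, and_self, not_true_eq_false, false_or, if_true,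
        hz, if_false, zero_add, hset]
      exact le_rfl
    · have h1 : ¬ ((x' = z ∧ ¬ x' = w) ∨ (x' = w ∧ ¬ x' = z)) := by
        rintro (⟨h, -⟩ | ⟨h, -⟩)
        · exact hz h.symm
        · exact hw h.symm
      rw [if_neg h1, if_neg hz, if_neg hw, add_zero]
  have hGsum : ∑ p : ↥Λ × ↥Λ, G p = β * ∑ y ∈ Λ, J x y * expectIn J Λ β h (spinAt y) := by
    have hA : ∑ p : ↥Λ × ↥Λ, (if p.1 = x' then β / 2 * J x p.2 * E {p.2} else 0) =
        ∑ y : ↥Λ, β / 2 * J x y * E {y} := by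
      rw [Fintype.sum_prod_type, Finset.sum_comm]
      simp only [Finset.sum_ite_eq', Finset.mem_univ, if_true]
    have hB : ∑ p : ↥Λ × ↥Λ, (if p.2 = x' then β / 2 * J p.1 x * E {p.1} else 0) =
        ∑ y : ↥Λ, β / 2 * J y x * E {y} := by
      rw [Fintype.sum_prod_type]
      simp only [Finset.sum_ite_eq', Finset.mem_univ, if_true]
    have h1 : ∑ y : ↥Λ, β / 2 * J x y * E {y} = β / 2 * ∑ y ∈ Λ, J x y * expectIn J Λ β h (spinAt y) := by
      rw [Finset.mul_sum, ← Finset.sum_coe_sort Λ]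
      refine Finset.sum_congr rfl fun y _ => ?_
      rw [hEy y]; ring
    have h2 : ∑ y : ↥Λ, β / 2 * J y x * E {y} = β / 2 * ∑ y ∈ Λ, J x y * expectIn J Λ β h (spinAt y) := by
      rw [Finset.mul_sum, ← Finset.sum_coe_sort Λ]
      refine Finset.sum_congr rfl fun y _ => ?_
      rw [hEy y, hJs]; ring
    simp only [hG, Finset.sum_add_distrib]
    rw [hA, hB, h1, h2]
    ring
  have hFinl : ∑ p : ↥Λ × ↥Λ, F (Sum.inl p) ≤ β * ∑ y ∈ Λ, J x y * expectIn J Λ β h (spinAt y) := by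
    rw [← hGsum]
    exact Finset.sum_le_sum fun p _ => hFG p
  -- assemble
  have hx1 : expectIn J Λ β h (spinAt x) = E {x'} := hEy x'
  rw [hx1]
  calc E {x'} ≤ ∑ i ∈ T, Real.tanh (K i) * E ({x'} ∆ C i) := hmain
    _ ≤ ∑ i, F i := hsumT
    _ = ∑ p : ↥Λ × ↥Λ, F (Sum.inl p) + ∑ z : ↥Λ, F (Sum.inr z) := Fintype.sum_sum_type F
    _ ≤ β * ∑ y ∈ Λ, J x y * expectIn J Λ β h (spinAt y) + β * h := add_le_add hFinl hFinr.le
    _ = β * h + β * ∑ y ∈ Λ, J x y * expectIn J Λ β h (spinAt y) := add_comm _ _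

/-- **Fisher's bound in finite volume**: if `∑_{y∈Λ} J_{x,y} ≤ S` for all `x ∈ Λ` and `βS < 1`,
then `⟨σ_x⟩_{Λ,J,h,β} ≤ βh/(1 - βS)` for every `x ∈ Λ` (the largest one-point function `M` obeys
`M ≤ βh + βSM`). [cite: Panis2023Triviality, §1.2.1 (β_c ≥ |J|⁻¹, after Fisher 1967)] -/
theorem expectIn_spinAt_le_of_sum_le (hβ : 0 ≤ β) (hh : 0 ≤ h) (hJ : ∀ x y, 0 ≤ J x y)
    (hJs : ∀ x y, J x y = J y x) {S : ℝ} (hS : ∀ x ∈ Λ, ∑ y ∈ Λ, J x y ≤ S) (hβS : β * S < 1)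
    {x : Site d} (hx : x ∈ Λ) :
    expectIn J Λ β h (spinAt x) ≤ β * h / (1 - β * S) := by
  have hne : Λ.Nonempty := ⟨x, hx⟩
  obtain ⟨y₀, hy₀, hmax⟩ := Finset.exists_max_image Λ (fun y => expectIn J Λ β h (spinAt y)) hne
  set M := expectIn J Λ β h (spinAt y₀) with hM
  have hM0 : 0 ≤ M := by
    rw [hM, ← spinProduct_singleton_eq_spinAt]
    exact expectIn_spinProduct_nonneg_field J Λ β h hβ hh hJ {y₀}
  have h1 : M ≤ β * h + β * S * M := by
    calc M ≤ β * h + β * ∑ y ∈ Λ, J y₀ y * expectIn J Λ β h (spinAt y) :=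
          expectIn_spinAt_le J Λ β h hβ hh hJ hJs hy₀
      _ ≤ β * h + β * ∑ y ∈ Λ, J y₀ y * M := by
          gcongr with y hy
          · exact hJ _ _
          · exact hmax y hy
      _ = β * h + β * M * ∑ y ∈ Λ, J y₀ y := by rw [← Finset.sum_mul]; ring
      _ ≤ β * h + β * M * S := by gcongr; exact hS y₀ hy₀
      _ = β * h + β * S * M := by ring
  have h2 : M * (1 - β * S) ≤ β * h := by nlinarith
  have h3 : M ≤ β * h / (1 - β * S) := by
    rw [le_div_iff₀ (by linarith)]
    exact h2
  exact (hmax x hx).trans h3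

end OneSite

/-! ### The infinite-volume consequences: `⟨σ₀⟩_{J,h,β} ≤ βh/(1-β|J|)` and `m*(β) = 0` for `β|J| < 1` -/

section Fisher

variable {d : ℕ} (J : Site d → Site d → ℝ) (β : ℝ)

/-- **`⟨σ₀⟩_{J,h,β} ≤ βh/(1 - βS)`** for `βS < 1`, whenever all the row sums of `J` over boxes are
`≤ S` (`β ≥ 0`, `h ≥ 0`, `J ≥ 0` symmetric). [cite: Panis2023Triviality, §1.2.1 (β_c ≥ |J|⁻¹, after Fisher 1967)] -/
theorem state_spinAt_le_of_sum_le (hβ : 0 ≤ β) {h : ℝ} (hh : 0 ≤ h) (hJ : ∀ x y, 0 ≤ J x y)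
    (hJs : ∀ x y, J x y = J y x) {S : ℝ} (hS : ∀ (L : ℕ), ∀ x ∈ box d L, ∑ y ∈ box d L, J x y ≤ S)
    (hβS : β * S < 1) :
    state J β h (spinAt 0) ≤ β * h / (1 - β * S) := by
  rw [← spinProduct_singleton_eq_spinAt]
  refine le_of_tendsto' (tendsto_expectIn_box_field J β h hβ hh hJ {0}) fun L => ?_
  rw [spinProduct_singleton_eq_spinAt]
  exact expectIn_spinAt_le_of_sum_le J (box d L) β h hβ hh hJ hJs (hS L) hβS (zero_mem_box d L)

/-- **Fisher's theorem: no spontaneous magnetisation for `β|J| < 1`** — `m*(β) ≤ 0` (hence `= 0`)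
when `βS < 1` and the row sums of `J` are `≤ S`. [cite: Panis2023Triviality, §1.2.1 (β_c ≥ |J|⁻¹, after Fisher 1967)] -/
theorem magnetization_nonpos_of_mul_lt_one (hβ : 0 ≤ β) (hJ : ∀ x y, 0 ≤ J x y)
    (hJs : ∀ x y, J x y = J y x) {S : ℝ} (hS : ∀ (L : ℕ), ∀ x ∈ box d L, ∑ y ∈ box d L, J x y ≤ S)
    (hβS : β * S < 1) : magnetization J β ≤ 0 := by
  have hg : Tendsto (fun h : ℝ => β * h / (1 - β * S)) (𝓝[>] (0 : ℝ)) (𝓝 0) := by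
    have hc : Continuous fun h : ℝ => β * h / (1 - β * S) := by fun_prop
    have h1 := hc.tendsto 0
    simp only [mul_zero, zero_div] at h1
    exact tendsto_nhdsWithin_of_tendsto_nhds h1
  exact magnetization_le_of_le J β hβ hJ one_pos hg fun h hh _ =>
    state_spinAt_le_of_sum_le J β hβ hh.le hJ hJs hS hβS

/-- **`β_c ≥ |J|⁻¹`, set form**: a `β ≥ 0` with `m*(β) > 0` has `βS ≥ 1` (`S` any bound on the row
sums of `J`). [cite: Panis2023Triviality, §1.2.1 (β_c ≥ |J|⁻¹, after Fisher 1967)] -/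
theorem one_le_mul_of_magnetization_pos (hβ : 0 ≤ β) (hJ : ∀ x y, 0 ≤ J x y)
    (hJs : ∀ x y, J x y = J y x) {S : ℝ} (hS : ∀ (L : ℕ), ∀ x ∈ box d L, ∑ y ∈ box d L, J x y ≤ S)
    (hm : 0 < magnetization J β) : 1 ≤ β * S := by
  by_contra hlt
  exact absurd (magnetization_nonpos_of_mul_lt_one J β hβ hJ hJs hS (lt_of_not_ge hlt)) (not_le.2 hm)

end Fisher

end LongRangeIsing

end Literature.Barriers.CriticalPhenomena
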